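import Summits.Ventures.YMGap.Census.CrossingWeightRP
import Summits.Ventures.LatticeQCDFlow.Scoring.SU2CharacterRowIntegral
import HarnessLib

/-!
# Venture YMGap, track (b) — face merging for CHARACTER SUMS inside the torus configuration integral, and the
# lattice bookkeeping (distinct links) of a unit 3-cube

HONEST FRAMING: venture file of the cell `pub-ymgap` (QuantumFields programme), track (b); plumbing for the exact
evaluation of the unit-cube partition function `Z_cube({c_j}) = 1 + Σ_j d_j² c_j⁶` (the one-cube number of Tomboulis,
arXiv:0707.2179, App. A eq. (A.5)) in `CubeIntegral`.  Nothing here concerns (5.15), limits, confinement or a mass gap.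

* `faceSum J a g = Σ_{n ≤ J} a_n χ_n(g)` (characters `χ_n = U_n(a₀)`), `fR_eq_faceSum` (the plaquette function as a
  face sum of its holonomy), `continuous_faceSum`.
* **`integral_faceSum_merge`** — the face-merging rule of the character expansion for character SUMS inside a
  product Haar integral over the links of `(ℤ/Lℤ)^d`:
  `∫ (Σ_n a_n χ_n(α·U_e·β)) (Σ_m b_m χ_m(γ·U_e⁻¹)) P dU = ∫ (Σ_n a_n b_n/(n+1) χ_n(α·γ·β)) P dU` when `α, β, γ, P` do not
  depend on the link `e` (bilinearity + `LatticeQCDFlow.Scoring.integral_pi_su2_merge`, i.e. the convolution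
  identity `∫ χ_m(AV) χ_n(V⁻¹B) dV = [m=n] χ_n(AB)/(n+1)`).
* Distinctness of shifted sites / links on the torus with `1 < L` (`shift_ne_self'`, …, `edge_ne_of_site`,
  `edge_ne_of_dir`) — the side conditions "does not depend on the link `e`".

References: E. T. Tomboulis, arXiv:0707.2179, App. A §1 eq. (A.5) [cite: Tomboulis2007Confinement, App. A eq. (A.5)];
J.-M. Drouffe, J.-B. Zuber, Phys. Rept. 102 (1983) 1, §3.1 (character expansion, gluing of plaquettes) [folklore].
-/

noncomputable section

open MeasureTheory Finset Real Function Polynomial.Chebyshev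
open scoped BigOperators
open Literature.MathematicalPhysics.QuantumLattice
open Literature.MathematicalPhysics.QuantumFieldTheory
open Literature.MathematicalPhysics.QuantumFieldTheory.Tomboulis2007
open Literature.MathematicalPhysics.QuantumFieldTheory.WilsonRP
open Summit.Ventures.LatticeQCDFlow.Exactness
open Summit.Ventures.LatticeQCDFlow.Scoring

namespace Summit.Ventures.YMGap.Census

variable {d L : ℕ}

/-! ### Character sums of a group element -/

/-- `faceSum J a g = Σ_{n=0}^{J} a_n χ_n(g)` with `χ_n(g) = U_n(a₀(g))`. -/
def faceSum (J : ℕ) (a : ℕ → ℝ) (g : SU2) : ℝ :=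
  ∑ n ∈ Finset.range (J + 1), a n * (U ℝ n).eval (su2a0 g)

/-- `faceSum` only sees `a₀(g) = Re tr g / 2`. -/
theorem faceSum_congr_su2a0 (J : ℕ) (a : ℕ → ℝ) {g h : SU2} (hgh : su2a0 g = su2a0 h) :
    faceSum J a g = faceSum J a h := by
  simp only [faceSum, hgh]

/-- `faceSum J a 1 = Σ_n a_n (n+1)`. -/
theorem faceSum_one (J : ℕ) (a : ℕ → ℝ) : faceSum J a 1 = ∑ n ∈ Finset.range (J + 1), a n * ((n : ℝ) + 1) := by
  unfold faceSum
  have h1 : su2a0 (1 : SU2) = 1 := by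
    simp [su2a0, Matrix.trace]
  refine Finset.sum_congr rfl fun n _ => ?_
  rw [h1, chebyshevU_eval_one_nat]

/-- `faceSum J a` is continuous on `SU(2)`. -/
theorem continuous_faceSum (J : ℕ) (a : ℕ → ℝ) : Continuous (faceSum J a) := by
  unfold faceSum
  exact continuous_finsetSum _ fun n _ => continuous_const.mul (continuous_su2Character_comp n continuous_id)

/-- `χ_n` of a plaquette holonomy: `charR n (Re tr U_p) = U_n(a₀(U_p))`. -/
theorem charR_plaqRe (n : ℕ) (W : GaugeConfig d L SU2) (p : Plaquette d L) :
    charR n (plaqRe rhoFund W p) = (U ℝ n).eval (su2a0 (plaquetteHolonomy W p.1 p.2.1.1 p.2.1.2)) := by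
  unfold charR
  congr 1

/-- **The plaquette function as a face sum of the holonomy**: `f_c(U_p) = Σ_n stdCoef c n χ_n(U_p)`. -/
theorem fR_eq_faceSum (J : ℕ) (c : ℕ → ℝ) (W : GaugeConfig d L SU2) (p : Plaquette d L) :
    fR J c (plaqRe rhoFund W p) = faceSum J (stdCoef c) (plaquetteHolonomy W p.1 p.2.1.1 p.2.1.2) := by
  rw [← charSum_stdCoef]
  unfold charSum faceSum
  simp only [charR_plaqRe]

/-! ### Face merging for character sums inside the configuration integral -/

/-- **Face merging for character sums.**  On the links of `(ℤ/Lℤ)^d` with product Haar measure: if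
`α, β, γ : (links → SU(2)) → SU(2)` and `P` are continuous and do not depend on the link `e`, then
`∫ (Σ_n a_n χ_n(α U_e β)) (Σ_m b_m χ_m(γ U_e⁻¹)) P dU = ∫ (Σ_n (a_n b_n/(n+1)) χ_n(α γ β)) P dU`. -/
theorem integral_faceSum_merge [NeZero L] (e : Edge d L) (J : ℕ) (a b : ℕ → ℝ)
    (α β γ : GaugeConfig d L SU2 → SU2) (P : GaugeConfig d L SU2 → ℝ)
    (hα : ∀ W g, α (update W e g) = α W) (hβ : ∀ W g, β (update W e g) = β W)
    (hγ : ∀ W g, γ (update W e g) = γ W) (hP : ∀ W g, P (update W e g) = P W)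
    (hαc : Continuous α) (hβc : Continuous β) (hγc : Continuous γ) (hPc : Continuous P) :
    ∫ W, faceSum J a (α W * W e * β W) * faceSum J b (γ W * (W e)⁻¹) * P W
        ∂(Measure.pi fun _ : Edge d L => haarProbability SU2) =
      ∫ W, faceSum J (fun n => a n * b n / ((n : ℝ) + 1)) (α W * γ W * β W) * P W
        ∂(Measure.pi fun _ : Edge d L => haarProbability SU2) := by
  -- expand both sides into finite sums of single-character integrals
  have hcn : ∀ n : ℕ, Continuous fun W : GaugeConfig d L SU2 => (U ℝ n).eval (su2a0 (α W * W e * β W)) :=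
    fun n => continuous_su2Character_comp n ((hαc.mul (continuous_apply e)).mul hβc)
  have hcm : ∀ m : ℕ, Continuous fun W : GaugeConfig d L SU2 => (U ℝ m).eval (su2a0 (γ W * (W e)⁻¹)) :=
    fun m => continuous_su2Character_comp m (hγc.mul (continuous_apply e).inv)
  have hcr : ∀ n : ℕ, Continuous fun W : GaugeConfig d L SU2 => (U ℝ n).eval (su2a0 (α W * γ W * β W)) :=
    fun n => continuous_su2Character_comp n ((hαc.mul hγc).mul hβc)
  have hL : ∀ W : GaugeConfig d L SU2, faceSum J a (α W * W e * β W) * faceSum J b (γ W * (W e)⁻¹) * P W =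
      ∑ n ∈ Finset.range (J + 1), ∑ m ∈ Finset.range (J + 1), a n * b m *
        ((U ℝ n).eval (su2a0 (α W * W e * β W)) * (U ℝ m).eval (su2a0 (γ W * (W e)⁻¹)) * P W) := by
    intro W
    unfold faceSum
    rw [Finset.sum_mul_sum, Finset.sum_mul]
    refine Finset.sum_congr rfl fun n _ => ?_
    rw [Finset.sum_mul]
    refine Finset.sum_congr rfl fun m _ => ?_
    ring
  have hR : ∀ W : GaugeConfig d L SU2, faceSum J (fun n => a n * b n / ((n : ℝ) + 1)) (α W * γ W * β W) * P W =
      ∑ n ∈ Finset.range (J + 1), a n * b n / ((n : ℝ) + 1) * ((U ℝ n).eval (su2a0 (α W * γ W * β W)) * P W) := by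
    intro W
    unfold faceSum
    rw [Finset.sum_mul]
    refine Finset.sum_congr rfl fun n _ => ?_
    ring
  simp_rw [hL, hR]
  have hint1 : ∀ n m : ℕ, Integrable (fun W : GaugeConfig d L SU2 => a n * b m *
      ((U ℝ n).eval (su2a0 (α W * W e * β W)) * (U ℝ m).eval (su2a0 (γ W * (W e)⁻¹)) * P W))
      (Measure.pi fun _ : Edge d L => haarProbability SU2) := fun n m => by
    apply integrable_pi_su2_of_continuous
    exact continuous_const.mul (((hcn n).mul (hcm m)).mul hPc)
  have hint2 : ∀ n : ℕ, Integrable (fun W : GaugeConfig d L SU2 => a n * b n / ((n : ℝ) + 1) *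
      ((U ℝ n).eval (su2a0 (α W * γ W * β W)) * P W)) (Measure.pi fun _ : Edge d L => haarProbability SU2) :=
    fun n => by
    apply integrable_pi_su2_of_continuous
    exact continuous_const.mul ((hcr n).mul hPc)
  have hint3 : ∀ n : ℕ, Integrable (fun W : GaugeConfig d L SU2 => ∑ m ∈ Finset.range (J + 1), a n * b m *
      ((U ℝ n).eval (su2a0 (α W * W e * β W)) * (U ℝ m).eval (su2a0 (γ W * (W e)⁻¹)) * P W))
      (Measure.pi fun _ : Edge d L => haarProbability SU2) :=
    fun n => integrable_finsetSum _ fun m _ => hint1 n m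
  rw [integral_finsetSum _ (fun n _ => hint3 n), integral_finsetSum _ (fun n _ => hint2 n)]
  refine Finset.sum_congr rfl fun n hn => ?_
  rw [integral_finsetSum _ (fun m _ => hint1 n m)]
  have hterm : ∀ m ∈ Finset.range (J + 1),
      ∫ W, a n * b m * ((U ℝ n).eval (su2a0 (α W * W e * β W)) * (U ℝ m).eval (su2a0 (γ W * (W e)⁻¹)) * P W)
        ∂(Measure.pi fun _ : Edge d L => haarProbability SU2) =
      if n = m then a n * b n / ((n : ℝ) + 1) *
        ∫ W, (U ℝ n).eval (su2a0 (α W * γ W * β W)) * P W ∂(Measure.pi fun _ : Edge d L => haarProbability SU2)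
      else 0 := by
    intro m _
    rw [integral_const_mul, integral_pi_su2_merge e α β γ P hα hβ hγ hP hαc hβc hγc hPc n m]
    by_cases hnm : n = m
    · subst hnm
      rw [if_pos rfl, if_pos rfl]
      field_simp
    · rw [if_neg hnm, if_neg hnm, mul_zero]
  rw [Finset.sum_congr rfl hterm, Finset.sum_ite_eq, if_pos hn, integral_const_mul]

/-! ### Distinct sites and links of the torus (`1 < L`) -/

section Sites

variable [Fact (1 < L)]

/-- `x + e_a ≠ x`. -/
theorem shift_ne_self' (x : Site d L) (a : Fin d) : x.shift a ≠ x := by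
  intro h
  have h1 := congrFun h a
  simp [Site.shift] at h1

/-- `x ≠ x + e_a`. -/
theorem self_ne_shift' (x : Site d L) (a : Fin d) : x ≠ x.shift a := (shift_ne_self' x a).symm

/-- `x + e_a + e_c ≠ x` for `a ≠ c`. -/
theorem shift_shift_ne_self' (x : Site d L) {a c : Fin d} (hac : a ≠ c) : (x.shift a).shift c ≠ x := by
  intro h
  have h1 := congrFun h a
  simp [Site.shift, Pi.single_eq_of_ne hac] at h1

/-- `x + e_a ≠ x + e_c` for `a ≠ c`. -/
theorem shift_ne_shift' (x : Site d L) {a c : Fin d} (hac : a ≠ c) : x.shift a ≠ x.shift c := by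
  intro h
  have h1 := congrFun h a
  simp [Site.shift, Pi.single_eq_of_ne hac] at h1

/-- `x + e_c ≠ x + e_a + e_c`. -/
theorem shift_ne_shift_shift' (x : Site d L) (a c : Fin d) : x.shift c ≠ (x.shift a).shift c := by
  intro h
  have h1 := congrFun h a
  by_cases hac : a = c
  · subst hac
    simp [Site.shift] at h1
  · simp [Site.shift, Pi.single_eq_of_ne hac] at h1

omit [Fact (1 < L)] in
/-- Links at distinct sites are distinct. -/
theorem edge_ne_of_site {x y : Site d L} (h : x ≠ y) (a c : Fin d) : ((x, a) : Edge d L) ≠ (y, c) :=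
  fun e => h (Prod.mk.inj e).1

omit [Fact (1 < L)] in
/-- Links in distinct directions are distinct. -/
theorem edge_ne_of_dir (x y : Site d L) {a c : Fin d} (h : a ≠ c) : ((x, a) : Edge d L) ≠ (y, c) :=
  fun e => h (Prod.mk.inj e).2

end Sites

end Summit.Ventures.YMGap.Census

end
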